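import Literature.Topology.FourManifolds.HomotopySpheresSignatureProofs
import Literature.Topology.FourManifolds.HomotopySpheresBPCyclicThm75
import Literature.Topology.FourManifolds.HomotopySpheresGroupDischarge
import Literature.Topology.FourManifolds.HomotopySpheresBPOrderSignatureLeavesProofs
import Literature.Topology.FourManifolds.SmoothHomologicalOrientationProofs
import HarnessLib

/-!
# Kervaire–Milnor's Theorem 7.5 from Lemma 7.3, Smale's h-cobordism theorem and §2-additivity

Topic `Literature/Topology/FourManifolds`; second sibling proofs file of
`HomotopySpheresSignature.lean`, which vendors Kervaire–Milnor's Thm. 7.5 (*Groups of homotopy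
spheres I*, Ann. of Math. 77 (1963), pp. 529–530) on classes as the named fact
`Literature.Topology.FourManifolds.HomotopySphere.mk_eq_mk_iff_sigmaGen_dvd_sub`: "Let `Σ₁` and
`Σ₂` be homotopy spheres of dimension `4m - 1`, `m > 1`, which bound s-parallelizable manifolds
`M₁` and `M₂` respectively. Then `Σ₁` is h-cobordant to `Σ₂` if and only if
`σ(M₁) ≡ σ(M₂) mod σₘ`", and of `HomotopySpheresSignatureProofs.lean`, which proves its "only if"
half from Thm. 1.1, `σ(-M) = -σ(M)`, §2-additivity and Bredon VI.7.15. Everything in this file is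
**proved**; no definition and no named fact is introduced (D-0026).

## What this file adds

Both directions of Thm. 7.5, in the binder shape of the named fact, are derived from exactly
three inputs, each a distinct printed result
(`HomotopySphere.mk_eq_mk_iff_sigmaGen_dvd_sub_of_boundsContractible`):

1. **Lemma 7.3, in the form in which the proof of Thm. 7.5 invokes it** (hypothesis `h73`).
   Kervaire–Milnor p. 528: "LEMMA 7.3. Let `M` be a framed manifold of dimension `4m > 4`, bounded
   by a homology sphere. The homotopy groups of `M` can be killed by a sequence of framed
   spherical modifications if and only if the signature `σ(M)` is zero" — where "framed" means a
   trivialization of the *stable* tangent bundle `τ_M ⊕ ε` (Definition, p. 519), i.e. `M` is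
   s-parallelized — together with the last clause of Thm. 6.6 (p. 526: "If `bM` is a homology
   sphere, then `M₁` is contractible"; a disconnected `M` is first connected by framed
   modifications, loc. cit.) and "Recall that `bM₁ = bM`" (p. 514). It is used on p. 530 as:
   "since `σ(M) = -σ(M₁) + σ(M₂) + σ(M₀) = 0` it follows from 7.3 that `bM = -Σ₁ # Σ₂` belongs to
   the trivial h-cobordism class." In the tree's language (`HomotopySphere.signatureSet`: `M = c.W`
   compact s-parallelizable with `bM = Σ` as oriented manifolds, `σ(M)` the signature of the
   closed model `M ∪ cone(bM)`, footnote pp. 528–529): `0 ∈ signatureSet g m h Σ →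
   BoundsContractible n Σ`. (The orientation data carried by `signatureSet` only weaken this
   hypothesis: `σ(M) = 0` does not depend on them.) This surgery theorem (§§5–7, Milnor [17]) is
   not in the tree; it is the one remaining obstacle to `mk_eq_mk_iff_sigmaGen_dvd_sub_holds`
   beyond the two named facts below.
2. **Smale's h-cobordism theorem**, the named fact
   `Literature.Topology.FourManifolds.nonempty_diffeomorph_of_isHCobordant_of_five_le` (spc4.S15;
   Smale 1962, Milnor 1965 Thm. 9.1; Kervaire–Milnor, Remark p. 505), through which the tree's
   `Θₙ = HomotopySphereClass n` (oriented-diffeomorphism classes) is Kervaire–Milnor's h-cobordism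
   group for `n = 4m - 1 ≥ 7`, and from which the tree proves the group laws of Thm. 1.1
   (`HomotopySphereClass.groupLawFacts_of_hCobordism`, `HomotopySpheresGroupDischarge.lean`).
3. **Additivity of `σ` over connected sums along the boundary**, the named fact
   `HomotopySphere.add_mem_signatureSet_of_isOrientedConnectedSum` (`HomotopySpheresSignature.lean`;
   §2 pp. 506–508 and the first lines of the proof of Thm. 7.5, p. 529).

The other printed ingredients are theorems of the tree and are fed in: `σ(-M) = -σ(M)`
(`HomotopySphere.neg_mem_signatureSet_neg_holds`), Bredon VI.7.15 on `𝕊ⁿ`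
(`SmoothOrientation.existsUnique_isCompatible_holds`), Lemma 2.3 "⇐"
(`isHCobordant_sphere_of_boundsContractible_holds`), connected sums of homotopy spheres
(`HomotopySphere.exists_isOrientedConnectedSum_of_ne_two`), `π₁(Σ) = 1`
(`HomotopySphere.simplyConnectedSpace`), the dichotomy preserving/reversing for diffeomorphisms
out of a connected oriented manifold (`Diffeomorph.isOrientationPreserving_or_isOrientationReversing_holds`)
and `σₘ ℤ =` the group of signatures (`HomotopySphere.sphereSignatureSubgroup_eq_zmultiples`).

* `HomotopySphere.eq_zero_or_exists_mem_signatureSet_sphere_of_mem_sphereSignatureSubgroup` —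
  Kervaire–Milnor p. 529, "Clearly the corresponding signatures `σ(M₀) ∈ ℤ` form a group under
  addition": GIVEN §2-additivity and the group laws of `Θₙ`, every non-zero element of the
  subgroup of `ℤ` generated by the signatures of the oriented s-parallelizable manifolds bounded
  by the standard sphere (`HomotopySphere.sphereSignatureSubgroup`, all orientations) **is** such a
  signature: `-σ(M₀) = σ(-M₀)`, and `σ(M₀) + σ(M₀') = σ(M₀ # M₀')` with
  `b(M₀ # M₀') = 𝕊ⁿ # 𝕊ⁿ ≅ 𝕊ⁿ` (Lemma 2.1: `𝕊ⁿ` is the unit, products are unique). Hence every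
  non-zero multiple of `σₘ` is a `σ(M₀)` (`HomotopySphere.exists_mem_signatureSet_sphere_of_sigmaGen_dvd`).
* `HomotopySphere.mk_eq_mk_of_sigmaGen_dvd_sub_of_boundsContractible` — **Thm. 7.5, "if"**, in one
  dimension `n = 4m - 1`, `m > 1`: GIVEN Lemma 7.3 in that dimension (input 1), the h-cobordism
  theorem for homotopy `n`-spheres, §2-additivity in that dimension and the group laws
  `HomotopySphereClass.GroupLawFacts n`: `σₘ ∣ σ(M₁) - σ(M₂)` implies `[Σ₁] = [Σ₂]`. Proof as printed
  (pp. 529–530, with the roles of `Σ₁`, `Σ₂` exchanged, which avoids one orientation reversal):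
  choose `M₀` bounded by `𝕊ⁿ` with `σ(M₀) = σ(M₂) - σ(M₁)` (previous item; if `σ(M₁) = σ(M₂)` no `M₀`
  is needed); `M = M₁ # (-M₂) # M₀` is s-parallelizable, bounded by the homotopy sphere
  `Σ₁ # (-Σ₂) # 𝕊ⁿ`, with `σ(M) = σ(M₁) - σ(M₂) + σ(M₀) = 0`; by Lemma 7.3 `bM` bounds a contractible
  manifold, so it is h-cobordant to `𝕊ⁿ` (Lemma 2.3) and therefore diffeomorphic to it (Smale),
  by a diffeomorphism which preserves or reverses orientation; thus
  `[Σ₁] · [Σ₂]⁻¹ = [Σ₁ # (-Σ₂)] = [Σ₁ # (-Σ₂)] · [𝕊ⁿ] = [bM] = [𝕊ⁿ, ±o] = 1` in the group `Θₙ`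
  (`GroupLawFacts.exists_commGroup`), i.e. `[Σ₁] = [Σ₂]`.
* `HomotopySphere.sigmaGen_dvd_sub_of_mk_eq_mk_of_hCobordism` — **Thm. 7.5, "only if"**, from the
  h-cobordism theorem and §2-additivity alone: the reduction
  `HomotopySphere.sigmaGen_dvd_sub_of_mk_eq_mk_of_groupLawFacts` of the sibling file with its other
  inputs (`σ(-M) = -σ(M)`, Bredon VI.7.15, the group laws) discharged.
* `HomotopySphere.mk_eq_mk_iff_sigmaGen_dvd_sub_of_dim` — Thm. 7.5 in one dimension from the
  dimension-`n` inputs (the shape consumed by `HomotopySphereClass.isCyclic_of_coe_subset_bP`,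
  `HomotopySpheresBPCyclicThm75.lean`); `HomotopySphere.mk_eq_mk_iff_sigmaGen_dvd_sub_of_boundsContractible`
  — **Thm. 7.5 in the binder shape of `mk_eq_mk_iff_sigmaGen_dvd_sub`**, from inputs 1–3.
* `exists_commGroup_homotopySphereClass_isCyclic_seven_of_boundsContractible` — the summit-cone
  target next to this fact, `Literature.Topology.FourManifolds.exists_commGroup_homotopySphereClass_isCyclic_seven`
  ("`Θ₇` is a cyclic group under connected sum"), over the resulting frontier: Lemma 7.3 at
  `n = 7` (input 1), the h-cobordism theorem, §2-additivity, Lemma 3.4 "⇒"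
  (`HomotopySphere.nonempty_signatureSet_of_boundsParallelizable`) and `Θ₇ = bP₈`
  (`HomotopySphere.boundsParallelizable_seven`), through
  `exists_commGroup_homotopySphereClass_isCyclic_seven_of_dim_thm75` (`HomotopySpheresBPCyclicThm75.lean`,
  Cor. 7.6 without Lemma 7.4).
* Appendix: `HomotopySphere.boundsContractible_of_zero_mem_signatureSet_of_lemma73`,
  `HomotopySphere.mk_eq_mk_iff_sigmaGen_dvd_sub_of_lemma73` — input 1 may be supplied in the
  orientation-free form in which Lemma 7.3 is printed (an s-parallelizable null-cobordism `M` of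
  `Σ` with `σ(M) = 0` for some homological orientation of `M ∪ cone(bM)` ⇒ `Σ` bounds a
  contractible manifold), forgetting the compatibility data of `signatureSet`.
* Appendix 2: `HomotopySphere.boundsContractible_of_zero_mem_signatureSet_of_highlyConnected`,
  `HomotopySphere.mk_eq_mk_iff_sigmaGen_dvd_sub_of_highlyConnected` — input 1 split at the first
  line of the printed proof of Lemma 7.3 ("We may assume that `M` is `(k-1)`-connected", p. 529,
  by Thm. 5.5): that line is the tree's named fact
  `HomotopySphere.exists_highlyConnected_of_mem_signatureSet` (Kosinski X.2.2 with X.3.3), and what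
  remains of input 1 is the middle-dimensional half of Lemma 7.3 (Kosinski X.3.4 / X.3.6), for
  simply connected s-parallelizable `M` with `Hᵢ(M; ℤ) = 0`, `0 < i < 2m`, and `σ(M) = 0`.

## References

* M. Kervaire, J. Milnor, *Groups of homotopy spheres I*, Ann. of Math. 77 (1963), 504–537:
  Remark p. 505; §2, Lemmas 2.1–2.4 (pp. 505–508); p. 514 ("`bM₁ = bM`"); Definition of a framed
  manifold (p. 519); Thm. 6.6 (p. 526); Lemma 7.3 (pp. 528–529); p. 529 (definition of `σₘ`);
  Thm. 7.5 and its proof (pp. 529–530). doi:10.2307/1970128 [KervaireMilnorAnnals1963]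
* J. Milnor, *Lectures on the h-cobordism theorem*, Princeton (1965), Thm. 9.1. [MilnorHCobordism1965]
* S. Smale, *On the structure of manifolds*, Amer. J. Math. 84 (1962), Cor. 1.3. [Smale1962]
* A. Kosinski, *Differential Manifolds*, Academic Press (1993), Ch. X: Thm. (2.2) (p. 201),
  Prop. (3.3), Thm. (3.4), Cor. (3.6) and the proof of (3.4) (pp. 204–205). [Kosinski1993]
-/

open scoped Manifold ContDiff Topology
open Set Function
open Literature.AlgebraicTopology.SingularHomology (HomologicalOrientation)

noncomputable section

namespace Literature.Topology.FourManifolds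

namespace HomotopySphere

variable {n : ℕ}

/-! ### The signatures for the standard sphere form a group (Kervaire–Milnor p. 529) -/

/-- **"Clearly the corresponding signatures `σ(M₀) ∈ ℤ` form a group under addition"**
(Kervaire–Milnor 1963, p. 529, of the s-parallelizable `4m`-manifolds `M₀` bounded by the
`(4m-1)`-sphere): for `n + 1 = 4m`, `m > 1`, GIVEN the class-level group laws of `Θₙ`
(`HomotopySphereClass.GroupLawFacts n`: Lemma 2.1, the standard sphere with any orientation is a
unit and products are unique) and §2-additivity of `σ` over connected sums along the boundary in
dimension `n`, every element of the subgroup of `ℤ` generated by the signatures of the oriented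
s-parallelizable manifolds bounded by `(𝕊ⁿ, o)`, `o` ranging over all orientations
(`sphereSignatureSubgroup g m h`), is `0` or is itself such a signature (for the standard sphere
`HomotopySphere.sphere o = (𝕊ⁿ, o)` with some orientation `o`): the generating set is closed
under negation (`σ(-M₀) = -σ(M₀)`, `b(-M₀) = (𝕊ⁿ, -o)`; tree theorem
`neg_mem_signatureSet_neg_holds`) and under addition (`σ(M₀) + σ(M₀')` is the signature of
`M₀ # M₀'`, bounded by `(𝕊ⁿ, o) # (𝕊ⁿ, o')`, whose class is `[𝕊ⁿ, o] · [𝕊ⁿ, o'] = [𝕊ⁿ, o]`, so that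
it is diffeomorphic to `𝕊ⁿ` and the signature is transported to the standard sphere,
`exists_mem_signatureSet_sphere_of_diffeomorph`, Bredon VI.7.15). The element `0` is kept apart
because no bounding manifold is exhibited here for it (it is `σ(𝔻⁴ᵐ)`).
[cite: KervaireMilnorAnnals1963, §7, p. 529 (definition of σₘ), with §2 and Lemma 2.1] -/
theorem eq_zero_or_exists_mem_signatureSet_sphere_of_mem_sphereSignatureSubgroup
    (hG : HomotopySphereClass.GroupLawFacts n) {m : ℕ} {h : n + 1 = 4 * m} (hm : 1 < m)
    {g : HomologicalOrientation ℤ (EuclideanSpace ℝ (Fin n)) n}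
    (hadd : ∀ S T U : HomotopySphere n,
      IsOrientedConnectedSum S.orientation T.orientation U.orientation →
        ∀ σ ∈ signatureSet g m h S, ∀ τ ∈ signatureSet g m h T, σ + τ ∈ signatureSet g m h U)
    {x : ℤ} (hx : x ∈ sphereSignatureSubgroup g m h) :
    x = 0 ∨ ∃ o : SmoothOrientation (𝓡 n) (Metric.sphere (0 : EuclideanSpace ℝ (Fin (n + 1))) 1),
      x ∈ signatureSet g m h (HomotopySphere.sphere o) := by
  have hn0 : n ≠ 0 := by omega
  have hn2 : n ≠ 2 := by omega
  -- two signatures for the standard sphere add up to a signature for the standard sphere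
  have hadd' : ∀ {y z : ℤ}
      {o₁ o₂ : SmoothOrientation (𝓡 n) (Metric.sphere (0 : EuclideanSpace ℝ (Fin (n + 1))) 1)},
      y ∈ signatureSet g m h (HomotopySphere.sphere o₁) →
        z ∈ signatureSet g m h (HomotopySphere.sphere o₂) →
          ∃ o : SmoothOrientation (𝓡 n) (Metric.sphere (0 : EuclideanSpace ℝ (Fin (n + 1))) 1),
            y + z ∈ signatureSet g m h (HomotopySphere.sphere o) := by
    intro y z o₁ o₂ hy hz
    obtain ⟨U, hU⟩ := exists_isOrientedConnectedSum_of_ne_two hn0 hn2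
      (HomotopySphere.sphere o₁) (HomotopySphere.sphere o₂)
    have hsum : y + z ∈ signatureSet g m h U := hadd _ _ U hU y hy z hz
    -- `[(𝕊ⁿ, o₁) # (𝕊ⁿ, o₂)] = [𝕊ⁿ, o₁]`: the sphere is a right unit and products are unique
    have h1 : HomotopySphereClass.IsMul (HomotopySphereClass.mk (HomotopySphere.sphere o₁))
        (HomotopySphereClass.mk (HomotopySphere.sphere o₂)) (HomotopySphereClass.mk U) :=
      ⟨_, _, U, rfl, rfl, rfl, hU⟩
    have hUS : HomotopySphereClass.mk U = HomotopySphereClass.mk (HomotopySphere.sphere o₁) :=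
      hG.isMul_unique h1 (hG.isMul_sphere o₂ _)
    obtain ⟨ψ⟩ := HomotopySphereClass.nonempty_diffeomorph_of_mk_eq_mk hUS
    exact exists_mem_signatureSet_sphere_of_diffeomorph hn0
      SmoothOrientation.existsUnique_isCompatible_holds hsum ψ
  refine AddSubgroup.closure_induction (fun y hy => ?_) (Or.inl rfl)
    (fun y z _ _ hy hz => ?_) (fun y _ hy => ?_) hx
  · exact Or.inr (mem_iUnion.1 hy)
  · rcases hy with rfl | ⟨o₁, hy⟩
    · simpa using hz
    rcases hz with rfl | ⟨o₂, hz⟩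
    · simpa using Or.inr ⟨o₁, hy⟩
    exact Or.inr (hadd' hy hz)
  · rcases hy with rfl | ⟨o, hy⟩
    · simp
    exact Or.inr ⟨-o, neg_mem_signatureSet_neg_holds n m h hm g _ y hy⟩

/-- **Every non-zero multiple of `σₘ` is the signature of an oriented s-parallelizable manifold
bounded by the standard sphere** (Kervaire–Milnor 1963, p. 529: `σₘ` is "the generator of this
group", the group of the `σ(M₀)`), for `n + 1 = 4m`, `m > 1`, GIVEN the group laws of `Θₙ` and
§2-additivity in dimension `n`: `sphereSignatureSubgroup g m h = σₘ ℤ`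
(`sphereSignatureSubgroup_eq_zmultiples`) and the previous theorem. This is the manifold `M₀` with
prescribed `σ(M₀)` of the first line of the proof of Thm. 7.5 ("First suppose that
`σ(M₁) = σ(M₂) + σ(M₀)`", p. 529).
[cite: KervaireMilnorAnnals1963, §7, p. 529 (definition of σₘ; proof of Thm. 7.5, first line)] -/
theorem exists_mem_signatureSet_sphere_of_sigmaGen_dvd
    (hG : HomotopySphereClass.GroupLawFacts n) {m : ℕ} {h : n + 1 = 4 * m} (hm : 1 < m)
    {g : HomologicalOrientation ℤ (EuclideanSpace ℝ (Fin n)) n}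
    (hadd : ∀ S T U : HomotopySphere n,
      IsOrientedConnectedSum S.orientation T.orientation U.orientation →
        ∀ σ ∈ signatureSet g m h S, ∀ τ ∈ signatureSet g m h T, σ + τ ∈ signatureSet g m h U)
    {x : ℤ} (hx : (sigmaGen g m h : ℤ) ∣ x) (hx0 : x ≠ 0) :
    ∃ o : SmoothOrientation (𝓡 n) (Metric.sphere (0 : EuclideanSpace ℝ (Fin (n + 1))) 1),
      x ∈ signatureSet g m h (HomotopySphere.sphere o) := by
  refine (eq_zero_or_exists_mem_signatureSet_sphere_of_mem_sphereSignatureSubgroup hG hm hadd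
    ?_).resolve_left hx0
  rw [sphereSignatureSubgroup_eq_zmultiples]
  exact Int.mem_zmultiples_iff.2 hx

/-! ### Theorem 7.5, "if", from Lemma 7.3 -/

/-- **Kervaire–Milnor Thm. 7.5, "if", in one dimension, from Lemma 7.3** (*Groups of homotopy
spheres I* (1963), pp. 529–530). Let `n + 1 = 4m`, `m > 1`, and assume, in dimension `n`:
(`hG`) the class-level group laws of `Θₙ` (Lemmas 2.1–2.4 with Smale;
`HomotopySphereClass.GroupLawFacts n`); (`h73`) **Lemma 7.3 as invoked in the proof of Thm. 7.5**:
a homotopy `n`-sphere `Σ = bM`, `M` compact s-parallelizable ("framed" = s-parallelized,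
Definition p. 519) with `σ(M) = 0`, bounds a contractible manifold (Lemma 7.3, p. 528: "the
homotopy groups of `M` can be killed by a sequence of framed spherical modifications if and only
if `σ(M)` is zero", with Thm. 6.6, p. 526: "If `bM` is a homology sphere, then `M₁` is
contractible", and `bM₁ = bM`, p. 514) — here `0 ∈ signatureSet g m h Σ → BoundsContractible n Σ`;
(`hcob`) h-cobordant homotopy `n`-spheres are diffeomorphic (Smale; Remark p. 505); (`hadd`)
§2-additivity of `σ` over connected sums along the boundary. If `σ ∈ signatureSet g m h Σ₁`,
`τ ∈ signatureSet g m h Σ₂` and `σₘ ∣ σ - τ`, then `[Σ₁] = [Σ₂]` in `Θₙ`. Proof as printed (with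
`Σ₁`, `Σ₂` exchanged): take `M₀` bounded by `𝕊ⁿ` with `σ(M₀) = τ - σ`
(`exists_mem_signatureSet_sphere_of_sigmaGen_dvd`; none is needed if `σ = τ`); the connected sum
along the boundary `M = M₁ # (-M₂) # M₀` is s-parallelizable, bounded by `Σ₁ # (-Σ₂) # 𝕊ⁿ`, and
`σ(M) = σ - τ + (τ - σ) = 0`, so "it follows from 7.3 that `bM` belongs to the trivial h-cobordism
class" (p. 530): `bM` bounds a contractible manifold, is h-cobordant to `𝕊ⁿ` (Lemma 2.3,
`isHCobordant_sphere_of_boundsContractible_holds`), hence diffeomorphic to `𝕊ⁿ` by a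
diffeomorphism preserving or reversing orientation, and
`[Σ₁] · [Σ₂]⁻¹ = [Σ₁ # (-Σ₂)] · [𝕊ⁿ, o] = [bM] = [𝕊ⁿ, ±o₀] = 1` in the group `Θₙ`
(`GroupLawFacts.exists_commGroup`). [cite: KervaireMilnorAnnals1963, Thm. 7.5, proof of "if" (pp. 529–530), with Lemma 7.3 (p. 528), Thm. 6.6 (p. 526), Lemma 2.3 (p. 506)] -/
theorem mk_eq_mk_of_sigmaGen_dvd_sub_of_boundsContractible
    (hG : HomotopySphereClass.GroupLawFacts n) {m : ℕ} {h : n + 1 = 4 * m} (hm : 1 < m)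
    {g : HomologicalOrientation ℤ (EuclideanSpace ℝ (Fin n)) n}
    (h73 : ∀ S : HomotopySphere n, (0 : ℤ) ∈ signatureSet g m h S → BoundsContractible n S.carrier)
    (hcob : ∀ U V : HomotopySphere n,
      U.IsHCobordant V → Nonempty (U.carrier ≃ₘ⟮𝓡 n, 𝓡 n⟯ V.carrier))
    (hadd : ∀ S T U : HomotopySphere n,
      IsOrientedConnectedSum S.orientation T.orientation U.orientation →
        ∀ σ ∈ signatureSet g m h S, ∀ τ ∈ signatureSet g m h T, σ + τ ∈ signatureSet g m h U)
    {S T : HomotopySphere n} {σ τ : ℤ} (hσ : σ ∈ signatureSet g m h S)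
    (hτ : τ ∈ signatureSet g m h T) (hdvd : (sigmaGen g m h : ℤ) ∣ σ - τ) :
    HomotopySphereClass.mk S = HomotopySphereClass.mk T := by
  have hn0 : n ≠ 0 := by omega
  have hn2 : n ≠ 2 := by omega
  have h2 : 2 ≤ n := by omega
  obtain ⟨o₀⟩ := (isOrientable_sphere_holds n : Nonempty _)
  obtain ⟨inst, hmul, hone, hinv⟩ := hG.exists_commGroup o₀
  -- `-τ = σ(-M₂)` occurs for `-Σ₂`, and `σ - τ = σ(M₁ # (-M₂))` for `Σ₁ # (-Σ₂)`
  have hτ' : -τ ∈ signatureSet g m h T.neg := neg_mem_signatureSet_neg_holds n m h hm g T τ hτ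
  obtain ⟨U₁, hU₁⟩ := exists_isOrientedConnectedSum_of_ne_two hn0 hn2 S T.neg
  have hsum₁ : σ + -τ ∈ signatureSet g m h U₁ := hadd S T.neg U₁ hU₁ σ hσ (-τ) hτ'
  have hmk₁ : HomotopySphereClass.mk S * HomotopySphereClass.mk T.neg =
      HomotopySphereClass.mk U₁ :=
    hmul _ _ _ ⟨S, T.neg, U₁, rfl, rfl, rfl, hU₁⟩
  -- adjoin `M₀` with `σ(M₀) = τ - σ`, bounded by the standard sphere (unless `σ = τ` already):
  -- a homotopy sphere `bM` in the class of `Σ₁ # (-Σ₂)`, bounding an s-parallelizable `M`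
  -- with `σ(M) = 0`
  obtain ⟨U₂, h0, hmk₂⟩ : ∃ U₂ : HomotopySphere n, (0 : ℤ) ∈ signatureSet g m h U₂ ∧
      HomotopySphereClass.mk U₂ = HomotopySphereClass.mk U₁ := by
    by_cases hστ : σ - τ = 0
    · refine ⟨U₁, ?_, rfl⟩
      have h00 : σ + -τ = 0 := by rw [← sub_eq_add_neg]; exact hστ
      exact h00 ▸ hsum₁
    · have hdvd' : (sigmaGen g m h : ℤ) ∣ τ - σ := by
        have hrw : τ - σ = -(σ - τ) := by ring
        rw [hrw]
        exact (dvd_neg).2 hdvd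
      have hne : τ - σ ≠ 0 := fun h0 => hστ (by omega)
      obtain ⟨o, ho⟩ := exists_mem_signatureSet_sphere_of_sigmaGen_dvd hG hm hadd hdvd' hne
      obtain ⟨U₂, hU₂⟩ :=
        exists_isOrientedConnectedSum_of_ne_two hn0 hn2 U₁ (HomotopySphere.sphere o)
      have hsum₂ : σ + -τ + (τ - σ) ∈ signatureSet g m h U₂ := hadd U₁ _ U₂ hU₂ _ hsum₁ _ ho
      have h00 : σ + -τ + (τ - σ) = 0 := by ring
      refine ⟨U₂, h00 ▸ hsum₂, ?_⟩
      have hmk₂ : HomotopySphereClass.mk U₁ * HomotopySphereClass.mk (HomotopySphere.sphere o) =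
          HomotopySphereClass.mk U₂ :=
        hmul _ _ _ ⟨U₁, _, U₂, rfl, rfl, rfl, hU₂⟩
      rw [← hmk₂, HomotopySphereClass.mk_sphere, hone o, mul_one]
  -- Lemma 7.3: `bM` bounds a contractible manifold, ...
  have hbc : BoundsContractible n U₂.carrier := h73 U₂ h0
  -- ... hence is h-cobordant to `𝕊ⁿ` (Lemma 2.3), hence diffeomorphic to it (Smale)
  haveI := U₂.simplyConnectedSpace h2
  have hh : U₂.IsHCobordant (HomotopySphere.sphere o₀) :=
    isHCobordant_sphere_of_boundsContractible_holds n U₂.carrier h2 hbc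
  obtain ⟨ψ⟩ := hcob U₂ (HomotopySphere.sphere o₀) hh
  haveI : ConnectedSpace U₂.carrier := U₂.connectedSpace hn0
  have hU₂1 : HomotopySphereClass.mk U₂ = 1 := by
    rcases Diffeomorph.isOrientationPreserving_or_isOrientationReversing_holds ψ (by simp)
      U₂.orientation o₀ with hψ | hψ
    · exact (HomotopySphereClass.sound
        (⟨ψ, hψ⟩ : U₂.IsOrientedDiffeomorphic (.sphere o₀))).trans (hone o₀)
    · exact (HomotopySphereClass.sound
        (⟨ψ, hψ⟩ : U₂.IsOrientedDiffeomorphic (.sphere (-o₀)))).trans (hone (-o₀))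
  -- so `[Σ₁] · [Σ₂]⁻¹ = [Σ₁ # (-Σ₂)] = [bM] = 1`
  have hkey : HomotopySphereClass.mk S * (HomotopySphereClass.mk T)⁻¹ = 1 := by
    rw [hinv, HomotopySphereClass.neg_mk, hmk₁, ← hmk₂, hU₂1]
  exact mul_inv_eq_one.1 hkey

/-! ### Theorem 7.5, "only if", from the h-cobordism theorem and §2-additivity -/

/-- **Kervaire–Milnor Thm. 7.5, "only if", from Smale's h-cobordism theorem and §2-additivity
alone** (*Groups of homotopy spheres I* (1963), p. 530: "Conversely … `σ(M) ≡ 0 (mod σₘ)`. But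
`σ(M) = -σ(M₁) + σ(M₂)`"), in the binder shape of the named fact `mk_eq_mk_iff_sigmaGen_dvd_sub`:
GIVEN the h-cobordism theorem (`nonempty_diffeomorph_of_isHCobordant_of_five_le`, spc4.S15, from
which the tree proves the group laws of `Θₙ`, `n ≥ 5`:
`HomotopySphereClass.groupLawFacts_of_hCobordism`) and §2-additivity
(`add_mem_signatureSet_of_isOrientedConnectedSum`), for `n + 1 = 4m`, `m > 1`: `[Σ₁] = [Σ₂]` implies
`σₘ ∣ σ(M₁) - σ(M₂)`. This is `sigmaGen_dvd_sub_of_mk_eq_mk_of_groupLawFacts`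
(`HomotopySpheresSignatureProofs.lean`) with `σ(-M) = -σ(M)` (`neg_mem_signatureSet_neg_holds`) and
Bredon VI.7.15 (`SmoothOrientation.existsUnique_isCompatible_holds`) now theorems of the tree.
[cite: KervaireMilnorAnnals1963, Thm. 7.5, proof of "only if" (p. 530), with Remark p. 505] [cite: MilnorHCobordism1965, Thm. 9.1] -/
theorem sigmaGen_dvd_sub_of_mk_eq_mk_of_hCobordism
    (hcob : FourManifolds.nonempty_diffeomorph_of_isHCobordant_of_five_le.{0})
    (hadd : add_mem_signatureSet_of_isOrientedConnectedSum) :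
    ∀ (n m : ℕ) (h : n + 1 = 4 * m), 1 < m →
      ∀ (g : HomologicalOrientation ℤ (EuclideanSpace ℝ (Fin n)) n) (S T : HomotopySphere n)
        (σ τ : ℤ), σ ∈ signatureSet g m h S → τ ∈ signatureSet g m h T →
          HomotopySphereClass.mk S = HomotopySphereClass.mk T → (sigmaGen g m h : ℤ) ∣ σ - τ := by
  intro n m h hm g S T σ τ hσ hτ hST
  exact sigmaGen_dvd_sub_of_mk_eq_mk_of_groupLawFacts
    (HomotopySphereClass.groupLawFacts_of_hCobordism (by omega) hcob) neg_mem_signatureSet_neg_holds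
    hadd h hm SmoothOrientation.existsUnique_isCompatible_holds g hσ hτ hST

/-! ### Theorem 7.5 from Lemma 7.3, the h-cobordism theorem and §2-additivity -/

/-- **Kervaire–Milnor Thm. 7.5 in one dimension, from dimension-`n` inputs** (*Groups of homotopy
spheres I* (1963), pp. 529–530): for `n + 1 = 4m`, `m > 1`, GIVEN in dimension `n` the group laws
of `Θₙ` (`hG`), Lemma 7.3 as invoked on p. 530 (`h73`: an s-parallelizable `M` bounded by a
homotopy sphere with `σ(M) = 0` has `bM` bounding a contractible manifold), the h-cobordism
theorem for homotopy `n`-spheres (`hcob`) and §2-additivity (`hadd`): for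
`σ ∈ signatureSet g m h Σ₁`, `τ ∈ signatureSet g m h Σ₂`, `[Σ₁] = [Σ₂] ↔ σₘ ∣ σ - τ` — the shape of
hypothesis `h75` of `HomotopySphereClass.isCyclic_of_coe_subset_bP`
(`HomotopySpheresBPCyclicThm75.lean`). "Only if" as in `sigmaGen_dvd_sub_of_mk_eq_mk_of_commGroup`
(sibling file: `[-Σ₁ # Σ₂] = [Σ₁]⁻¹ · [Σ₂] = 1`, so `-σ + τ` is transported to the standard sphere and
is a multiple of `σₘ`), with `σ(-M) = -σ(M)` and Bredon VI.7.15 discharged; "if" by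
`mk_eq_mk_of_sigmaGen_dvd_sub_of_boundsContractible`.
[cite: KervaireMilnorAnnals1963, Thm. 7.5 (pp. 529–530), with Lemma 7.3 (p. 528)] -/
theorem mk_eq_mk_iff_sigmaGen_dvd_sub_of_dim
    (hG : HomotopySphereClass.GroupLawFacts n) {m : ℕ} (h : n + 1 = 4 * m) (hm : 1 < m)
    (g : HomologicalOrientation ℤ (EuclideanSpace ℝ (Fin n)) n)
    (h73 : ∀ S : HomotopySphere n, (0 : ℤ) ∈ signatureSet g m h S → BoundsContractible n S.carrier)
    (hcob : ∀ U V : HomotopySphere n,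
      U.IsHCobordant V → Nonempty (U.carrier ≃ₘ⟮𝓡 n, 𝓡 n⟯ V.carrier))
    (hadd : ∀ S T U : HomotopySphere n,
      IsOrientedConnectedSum S.orientation T.orientation U.orientation →
        ∀ σ ∈ signatureSet g m h S, ∀ τ ∈ signatureSet g m h T, σ + τ ∈ signatureSet g m h U)
    (S T : HomotopySphere n) (σ τ : ℤ) (hσ : σ ∈ signatureSet g m h S)
    (hτ : τ ∈ signatureSet g m h T) :
    HomotopySphereClass.mk S = HomotopySphereClass.mk T ↔ (sigmaGen g m h : ℤ) ∣ σ - τ := by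
  refine ⟨fun hST => ?_,
    mk_eq_mk_of_sigmaGen_dvd_sub_of_boundsContractible hG hm h73 hcob hadd hσ hτ⟩
  have hn0 : n ≠ 0 := by omega
  have hn2 : n ≠ 2 := by omega
  obtain ⟨o₀⟩ := (isOrientable_sphere_holds n : Nonempty _)
  obtain ⟨inst, hmul, hone, hinv⟩ := hG.exists_commGroup o₀
  -- `-σ + τ = σ((-M₁) # M₂)` occurs for `-Σ₁ # Σ₂`, whose class is `[Σ₁]⁻¹ · [Σ₂] = 1 = [𝕊ⁿ]`
  have hσ' : -σ ∈ signatureSet g m h S.neg := neg_mem_signatureSet_neg_holds n m h hm g S σ hσ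
  obtain ⟨U, hU⟩ := exists_isOrientedConnectedSum_of_ne_two hn0 hn2 S.neg T
  have hsum : -σ + τ ∈ signatureSet g m h U := hadd S.neg T U hU (-σ) hσ' τ hτ
  have hmulU : HomotopySphereClass.mk S.neg * HomotopySphereClass.mk T =
      HomotopySphereClass.mk U :=
    hmul _ _ _ ⟨S.neg, T, U, rfl, rfl, rfl, hU⟩
  have hU1 : HomotopySphereClass.mk U = 1 := by
    rw [← hmulU, ← HomotopySphereClass.neg_mk, ← hinv, hST, inv_mul_cancel]
  have hUS : HomotopySphereClass.mk U = HomotopySphereClass.mk (HomotopySphere.sphere o₀) :=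
    hU1.trans (hone o₀).symm
  -- so `-Σ₁ # Σ₂` is diffeomorphic to `𝕊ⁿ` and `-σ + τ` is a multiple of `σₘ`
  obtain ⟨ψ⟩ := HomotopySphereClass.nonempty_diffeomorph_of_mk_eq_mk hUS
  obtain ⟨o, ho⟩ := exists_mem_signatureSet_sphere_of_diffeomorph hn0
    SmoothOrientation.existsUnique_isCompatible_holds hsum ψ
  have hdvd : (sigmaGen g m h : ℤ) ∣ -σ + τ :=
    sigmaGen_dvd_of_mem_sphereSignatureSubgroup (mem_sphereSignatureSubgroup ho)
  have hrw : σ - τ = -(-σ + τ) := by ring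
  rw [hrw]
  exact (dvd_neg).2 hdvd

/-- **Kervaire–Milnor Thm. 7.5** (*Groups of homotopy spheres I* (1963), pp. 529–530: "Let `Σ₁`
and `Σ₂` be homotopy spheres of dimension `4m - 1`, `m > 1`, which bound s-parallelizable
manifolds `M₁` and `M₂` respectively. Then `Σ₁` is h-cobordant to `Σ₂` if and only if
`σ(M₁) ≡ σ(M₂) mod σₘ`"), in the binder shape of the named fact
`mk_eq_mk_iff_sigmaGen_dvd_sub`, **from three printed inputs**: (`h73`) Lemma 7.3 in the form in
which p. 530 invokes it — for every `n + 1 = 4m`, `m > 1`, a homotopy sphere bounding a compact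
s-parallelizable `M` with `σ(M) = 0` bounds a contractible manifold (Lemma 7.3, p. 528, "framed"
being a trivialization of the stable tangent bundle, p. 519; Thm. 6.6, p. 526; `bM₁ = bM`, p. 514;
the surgery of §§5–7, not in the tree); (`hcob`) Smale's h-cobordism theorem, the named fact
`nonempty_diffeomorph_of_isHCobordant_of_five_le` (Remark p. 505: `Θₙ` is the set of diffeomorphism
classes for `n ≠ 3, 4`; it also yields Thm. 1.1, `HomotopySphereClass.groupLawFacts_of_hCobordism`);
(`hadd`) §2-additivity of `σ` over connected sums along the boundary, the named fact
`add_mem_signatureSet_of_isOrientedConnectedSum`. All other ingredients of the printed proof are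
theorems of the tree (module docstring). Consequently `mk_eq_mk_iff_sigmaGen_dvd_sub_holds` is
exactly as far away as these three inputs.
[cite: KervaireMilnorAnnals1963, Thm. 7.5 (pp. 529–530), with Lemma 7.3 (p. 528), Thm. 6.6 (p. 526), §2 and Remark p. 505] [cite: MilnorHCobordism1965, Thm. 9.1] -/
theorem mk_eq_mk_iff_sigmaGen_dvd_sub_of_boundsContractible
    (h73 : ∀ (n m : ℕ) (h : n + 1 = 4 * m), 1 < m →
      ∀ (g : HomologicalOrientation ℤ (EuclideanSpace ℝ (Fin n)) n) (S : HomotopySphere n),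
        (0 : ℤ) ∈ signatureSet g m h S → BoundsContractible n S.carrier)
    (hcob : FourManifolds.nonempty_diffeomorph_of_isHCobordant_of_five_le.{0})
    (hadd : add_mem_signatureSet_of_isOrientedConnectedSum) :
    mk_eq_mk_iff_sigmaGen_dvd_sub := by
  intro n m h hm g S T σ τ hσ hτ
  have h5 : 5 ≤ n := by omega
  exact mk_eq_mk_iff_sigmaGen_dvd_sub_of_dim (HomotopySphereClass.groupLawFacts_of_hCobordism h5 hcob)
    h hm g (h73 n m h hm g) (nonempty_diffeomorph_of_isHCobordant hcob h5) (hadd n m h g) S T σ τ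
    hσ hτ

end HomotopySphere

/-! ### The cone target `Θ₇` cyclic, over the resulting frontier -/

/-- **`Θ₇` is a cyclic group under connected sum, from Lemma 7.3 at `n = 7`, Smale's h-cobordism
theorem, §2-additivity, Lemma 3.4 "⇒" and `Θ₇ = bP₈`.** The target
`Literature.Topology.FourManifolds.exists_commGroup_homotopySphereClass_isCyclic_seven` GIVEN:
(`h73`) Lemma 7.3 as invoked on p. 530, at `n = 7`, `m = 2` (an s-parallelizable `8`-manifold `M`
bounded by a homotopy `7`-sphere with `σ(M) = 0` has `bM` bounding a contractible manifold;
Kervaire–Milnor Lemma 7.3 p. 528 with Thm. 6.6 p. 526); (`hcob`) the h-cobordism theorem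
(`nonempty_diffeomorph_of_isHCobordant_of_five_le`), which gives both the group `Θ₇` (Thm. 1.1,
`HomotopySphereClass.groupLawFacts_of_hCobordism`) and, with `h73`, Thm. 7.5 at `n = 7`
(`HomotopySphere.mk_eq_mk_iff_sigmaGen_dvd_sub_of_dim`); (`hadd`) §2-additivity
(`HomotopySphere.add_mem_signatureSet_of_isOrientedConnectedSum`); (`hne`) Lemma 3.4 "⇒"
(`HomotopySphere.nonempty_signatureSet_of_boundsParallelizable`); (`hB`) `Θ₇ = bP₈` (§4, table
p. 512; `HomotopySphere.boundsParallelizable_seven`). Assembly by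
`exists_commGroup_homotopySphereClass_isCyclic_seven_of_dim_thm75` (Cor. 7.6, first sentence, at
`m = 2`: `Θ₇ = bP₈ ↪ ℤ/σ₂`; no Lemma 7.4), the generator convention being the theorem
`isOrientableOver_int_euclideanSpace`.
[cite: KervaireMilnorAnnals1963, Cor. 7.6 (p. 530, first sentence) at m = 2, with Thm. 7.5, Lemma 7.3 (p. 528), §4 table p. 512 and Remark p. 505] -/
theorem exists_commGroup_homotopySphereClass_isCyclic_seven_of_boundsContractible
    (h73 : ∀ (g : HomologicalOrientation ℤ (EuclideanSpace ℝ (Fin 7)) 7) (h : 7 + 1 = 4 * 2)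
      (S : HomotopySphere 7),
        (0 : ℤ) ∈ HomotopySphere.signatureSet g 2 h S → BoundsContractible 7 S.carrier)
    (hcob : FourManifolds.nonempty_diffeomorph_of_isHCobordant_of_five_le.{0})
    (hadd : HomotopySphere.add_mem_signatureSet_of_isOrientedConnectedSum)
    (hne : HomotopySphere.nonempty_signatureSet_of_boundsParallelizable)
    (hB : HomotopySphere.boundsParallelizable_seven) :
    exists_commGroup_homotopySphereClass_isCyclic_seven := by
  -- a generator convention for `H₇(ℝ⁷ | pt; ℤ)`
  obtain ⟨g⟩ := isOrientableOver_int_euclideanSpace 7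
  have h : 7 + 1 = 4 * 2 := by norm_num
  -- Thm. 1.1 at `n = 7` from the h-cobordism theorem
  have hG : HomotopySphereClass.GroupLawFacts 7 :=
    HomotopySphereClass.groupLawFacts_of_hCobordism (by norm_num) hcob
  obtain ⟨o₀⟩ := (isOrientable_sphere_holds 7 : Nonempty _)
  obtain ⟨inst, hmul, -, -⟩ := hG.exists_commGroup o₀
  exact exists_commGroup_homotopySphereClass_isCyclic_seven_of_dim_thm75 ⟨inst, hmul⟩ hB g h
    (HomotopySphere.mk_eq_mk_iff_sigmaGen_dvd_sub_of_dim hG h (by norm_num) g (h73 g h)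
      (HomotopySphere.nonempty_diffeomorph_of_isHCobordant hcob (by norm_num)) (hadd 7 2 h g))
    (hadd 7 2 h g) (hne 7 2 h g)

/-! ### Appendix: Lemma 7.3 stated on bounding manifolds, orientation-free -/

namespace HomotopySphere

variable {n : ℕ}

/-- **The orientation-free form of Lemma 7.3 (with Thm. 6.6) implies the form `h73` used above.**
Kervaire–Milnor's Lemma 7.3 (p. 528) speaks of a framed (= s-parallelized, Definition p. 519)
`4m`-manifold `M`, `4m > 4`, bounded by a homology sphere, with `σ(M) = 0` — no orientation
conventions enter, `σ(M) = 0` being insensitive to them — and concludes, with Thm. 6.6 (p. 526)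
and `bM₁ = bM` (p. 514), that `bM` bounds a contractible manifold. Stated on the tree's bounding
manifolds: for every null-cobordism `M = c.W` of the homotopy sphere `Σ` (`c : NullCobordism n Σ`)
which is s-parallelizable, and every homological orientation `μ'` of its closed model
`M ∪ cone(bM)` with `σ(M) = μ'.signatureInDim = 0`, `Σ` bounds a contractible manifold. This
implies `0 ∈ signatureSet g m h Σ → BoundsContractible n Σ` for every generator convention `g`
(forget the compatibility data of `signatureSet`). [cite: KervaireMilnorAnnals1963, Lemma 7.3 (p. 528), with Definition p. 519, Thm. 6.6 (p. 526) and p. 514] -/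
theorem boundsContractible_of_zero_mem_signatureSet_of_lemma73 {m : ℕ} {h : n + 1 = 4 * m}
    {g : HomologicalOrientation ℤ (EuclideanSpace ℝ (Fin n)) n}
    (h73 : ∀ (S : HomotopySphere n) (c : NullCobordism n S.carrier)
      (μ' : HomologicalOrientation ℤ (ClosedModel n c.W) (n + 1)),
      IsStablyParallelizable (𝓡∂ (n + 1)) c.W →
        μ'.signatureInDim (show 2 * m + 2 * m = n + 1 by omega) = 0 →
          BoundsContractible n S.carrier)
    (S : HomotopySphere n) (h0 : (0 : ℤ) ∈ signatureSet g m h S) :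
    BoundsContractible n S.carrier := by
  obtain ⟨-, c, μ', -, hspar, -, hsig⟩ := h0
  exact h73 S c μ' hspar hsig

/-- **Kervaire–Milnor Thm. 7.5 from Lemma 7.3 stated orientation-free on bounding manifolds,
Smale's h-cobordism theorem and §2-additivity** — `mk_eq_mk_iff_sigmaGen_dvd_sub_of_boundsContractible`
with input 1 in the form of `boundsContractible_of_zero_mem_signatureSet_of_lemma73`: (`h73`) for
`n + 1 = 4m`, `m > 1`, every homotopy `n`-sphere `Σ = bM` with `M` compact s-parallelizable and
`σ(M) = 0` (for some homological orientation of the closed model `M ∪ cone(bM)`) bounds a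
contractible manifold (Lemma 7.3, p. 528, with Thm. 6.6, p. 526); (`hcob`) the named fact
`nonempty_diffeomorph_of_isHCobordant_of_five_le`; (`hadd`) the named fact
`add_mem_signatureSet_of_isOrientedConnectedSum`.
[cite: KervaireMilnorAnnals1963, Thm. 7.5 (pp. 529–530), with Lemma 7.3 (p. 528) and Thm. 6.6 (p. 526)] [cite: MilnorHCobordism1965, Thm. 9.1] -/
theorem mk_eq_mk_iff_sigmaGen_dvd_sub_of_lemma73
    (h73 : ∀ (n m : ℕ) (h : n + 1 = 4 * m), 1 < m →
      ∀ (S : HomotopySphere n) (c : NullCobordism n S.carrier)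
        (μ' : HomologicalOrientation ℤ (ClosedModel n c.W) (n + 1)),
        IsStablyParallelizable (𝓡∂ (n + 1)) c.W →
          μ'.signatureInDim (show 2 * m + 2 * m = n + 1 by omega) = 0 →
            BoundsContractible n S.carrier)
    (hcob : FourManifolds.nonempty_diffeomorph_of_isHCobordant_of_five_le.{0})
    (hadd : add_mem_signatureSet_of_isOrientedConnectedSum) :
    mk_eq_mk_iff_sigmaGen_dvd_sub :=
  mk_eq_mk_iff_sigmaGen_dvd_sub_of_boundsContractible
    (fun n m h hm _ S h0 => boundsContractible_of_zero_mem_signatureSet_of_lemma73 (h73 n m h hm) S h0)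
    hcob hadd

/-! ### Appendix 2: Lemma 7.3 split at "we may assume that `M` is `(k-1)`-connected"

Kervaire–Milnor prove Lemma 7.3 (p. 529) in two moves: "Conversely suppose that `σ(M) = 0`. We
may assume that `M` is `(k-1)`-connected" — by Thm. 5.5 (p. 514: framed spherical modifications
below the middle dimension make `M` `(k-1)`-connected without changing `bM` or the framing; the
signature is unchanged, footnote pp. 528–529) — and then the middle-dimensional argument
(pp. 528–529: `H_kM` free with a unimodular form of signature zero, a basis `{λᵢ, μⱼ}` with
`λᵢ·λⱼ = 0`, embedded spheres with trivial normal bundle by [17, Lemma 7], Lemma 7.1, Lemma 6.2,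
and Thm. 6.6: the resulting `k`-connected `M₁` with `bM₁ = bM` a homology sphere is contractible).
Kosinski, *Differential Manifolds* (1993), Ch. X, follows the same plan: Thm. 2.2 with Prop. 3.3
("in view of 2.2, we may assume that `M` is `(2n-1)`-connected", p. 205), then Thm. 3.4 and
Cor. 3.6 ("If a homotopy sphere `Σ` bounds a `π`-manifold `M` and `σ(M) = 0`, then `Σ` is
diffeomorphic to `S⁴ⁿ⁻¹`", through "`M'` is `2n`-connected … diffeomorphic to `D⁴ⁿ`", p. 205).
The first move is already a named fact of the tree, with its own seat:
`HomotopySphere.exists_highlyConnected_of_mem_signatureSet` (`HomotopySpheresBPOrderSignatureLeaves.lean`;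
Kosinski X.2.2 with X.3.3). The two theorems below therefore replace input 1 (`h73`) by the
conjunction of that named fact and the **middle-dimensional half of Lemma 7.3** (`h34`), stated,
exactly like the tree's rendering of Kosinski X.3.1 (`HomotopySphere.isEven_intersectionForm_closedModel`),
for null-cobordisms `M = c.W` of `Σ` that are simply connected with `Hᵢ(M; ℤ) = 0` for
`0 < i < 2m` (that is, `(2m-1)`-connected, by Hurewicz), s-parallelizable, and of signature zero
for some homological orientation of the closed model: then `Σ` bounds a contractible manifold.
Nothing new is asserted: `h34` is a hypothesis, weaker than `h73`. -/

/-- **Lemma 7.3 for `(2m-1)`-connected `M` together with Kosinski's X.2.2 gives Lemma 7.3 as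
invoked on p. 530.** For `n + 1 = 4m`, `m > 1` and a generator convention `g`: GIVEN (`h34`) the
middle-dimensional half of Kervaire–Milnor's Lemma 7.3 in dimension `n + 1` — every homotopy
`n`-sphere `Σ = bM` with `M = c.W` compact, simply connected, `Hᵢ(M; ℤ) = 0` for `0 < i < 2m`,
s-parallelizable and `σ(M) = 0` (for some homological orientation `μ'` of `M ∪ cone(bM)`) bounds a
contractible manifold (Kervaire–Milnor pp. 528–529 from "We may assume that `M` is
`(k-1)`-connected" on, with Thm. 6.6, p. 526; Kosinski X.3.4 and the proof of X.3.6, p. 205) — and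
(`hconn`) the tree's named fact `exists_highlyConnected_of_mem_signatureSet` (Kosinski X.2.2 with
X.3.3; Kervaire–Milnor Thm. 5.5: "By Theorem 5.5, we can assume that `M` is `(k-1)`-connected",
p. 528), **`0 ∈ signatureSet g m h Σ` implies that `Σ` bounds a contractible manifold**: realise
`σ = 0` by a `(2m-1)`-connected s-parallelizable null-cobordism (`hconn`) and apply `h34` to it.
[cite: KervaireMilnorAnnals1963, Lemma 7.3, proof pp. 528–529 ("We may assume that M is (k-1)-connected"), with Thm. 5.5 (p. 514) and Thm. 6.6 (p. 526)] [cite: Kosinski1993, Ch. X, Thm. (2.2), Thm. (3.4), Cor. (3.6) and p. 205] -/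
theorem boundsContractible_of_zero_mem_signatureSet_of_highlyConnected {m : ℕ} {h : n + 1 = 4 * m}
    (hm : 1 < m) {g : HomologicalOrientation ℤ (EuclideanSpace ℝ (Fin n)) n}
    (h34 : ∀ (S : HomotopySphere n) (c : NullCobordism n S.carrier)
      (μ' : HomologicalOrientation ℤ (ClosedModel n c.W) (n + 1)),
      SimplyConnectedSpace c.W →
      (∀ i : ℕ, 0 < i → i < 2 * m →
        Subsingleton (Literature.AlgebraicTopology.SingularHomology.singularHomology ℤ ℤ c.W i)) →
      IsStablyParallelizable (𝓡∂ (n + 1)) c.W →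
        μ'.signatureInDim (show 2 * m + 2 * m = n + 1 by omega) = 0 →
          BoundsContractible n S.carrier)
    (hconn : exists_highlyConnected_of_mem_signatureSet)
    (S : HomotopySphere n) (h0 : (0 : ℤ) ∈ signatureSet g m h S) :
    BoundsContractible n S.carrier := by
  obtain ⟨-, c, μ', hsc, hH, -, hspar, -, hsig⟩ := hconn n m h hm g S 0 h0
  exact h34 S c μ' hsc hH hspar hsig

/-- **Kervaire–Milnor Thm. 7.5 from the middle-dimensional half of Lemma 7.3, Kosinski's X.2.2,
Smale's h-cobordism theorem and §2-additivity** — `mk_eq_mk_iff_sigmaGen_dvd_sub_of_boundsContractible`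
with input 1 supplied by `boundsContractible_of_zero_mem_signatureSet_of_highlyConnected`:
(`h34`) for `n + 1 = 4m`, `m > 1`, every homotopy `n`-sphere bounding a compact, simply connected,
s-parallelizable `M` with `Hᵢ(M; ℤ) = 0` for `0 < i < 2m` and `σ(M) = 0` bounds a contractible
manifold (Kervaire–Milnor, proof of Lemma 7.3 from "We may assume that `M` is `(k-1)`-connected"
on, pp. 528–529, with Thm. 6.6; Kosinski X.3.4 / X.3.6 — framed surgery in the middle dimension,
not in the tree); (`hconn`) the named fact `exists_highlyConnected_of_mem_signatureSet` (Kosinski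
X.2.2, X.3.3; Kervaire–Milnor Thm. 5.5); (`hcob`) the named fact
`nonempty_diffeomorph_of_isHCobordant_of_five_le` (Smale); (`hadd`) the named fact
`add_mem_signatureSet_of_isOrientedConnectedSum` (§2). So `mk_eq_mk_iff_sigmaGen_dvd_sub_holds` is
`mk_eq_mk_iff_sigmaGen_dvd_sub_of_highlyConnected L hconn_holds hcob_holds hadd_holds` once the
middle-dimensional surgery lemma `L` and the three discharges exist.
[cite: KervaireMilnorAnnals1963, Thm. 7.5 (pp. 529–530), with Lemma 7.3 (pp. 528–529), Thm. 5.5 (p. 514) and Thm. 6.6 (p. 526)] [cite: Kosinski1993, Ch. X, Thm. (2.2), Thm. (3.4), Cor. (3.6)] [cite: MilnorHCobordism1965, Thm. 9.1] -/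
theorem mk_eq_mk_iff_sigmaGen_dvd_sub_of_highlyConnected
    (h34 : ∀ (n m : ℕ) (h : n + 1 = 4 * m), 1 < m →
      ∀ (S : HomotopySphere n) (c : NullCobordism n S.carrier)
        (μ' : HomologicalOrientation ℤ (ClosedModel n c.W) (n + 1)),
        SimplyConnectedSpace c.W →
        (∀ i : ℕ, 0 < i → i < 2 * m →
          Subsingleton (Literature.AlgebraicTopology.SingularHomology.singularHomology ℤ ℤ c.W i)) →
        IsStablyParallelizable (𝓡∂ (n + 1)) c.W →
          μ'.signatureInDim (show 2 * m + 2 * m = n + 1 by omega) = 0 →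
            BoundsContractible n S.carrier)
    (hconn : exists_highlyConnected_of_mem_signatureSet)
    (hcob : FourManifolds.nonempty_diffeomorph_of_isHCobordant_of_five_le.{0})
    (hadd : add_mem_signatureSet_of_isOrientedConnectedSum) :
    mk_eq_mk_iff_sigmaGen_dvd_sub :=
  mk_eq_mk_iff_sigmaGen_dvd_sub_of_boundsContractible
    (fun n m h hm _ S h0 =>
      boundsContractible_of_zero_mem_signatureSet_of_highlyConnected (h := h) hm (h34 n m h hm)
        hconn S h0)
    hcob hadd

end HomotopySphere

end Literature.Topology.FourManifolds
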